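/-
Copyright (c) 2026 the pub-hodgecm-mathlib formalisation cell (harness21).  Prover seat hodgecm-mathlib-F0P2-p01 (g15): road «S3-ram» (LEAD F0P3a-plan (g12); architect
A-p16 (g31) 23:19:27Z deal G2 of F0P3a-p01 (g16)'s (a2)(B) BLUEPRINT v1 899adc41; owner F0P3a-p06 (g15)), organ A′ (ii) «the RANK of the drop-1 child»; 2026-09-01.
-/
import Literature.NumberTheory.Automorphic.UnitaryLatticeTreeFixedChildClassRamified       -- ★ p847187 (this seat): second-order expansion `v_childFrame_conj_sub_lower_le`; brings ★ p847102, ★ p847085, ★ p847060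
import Literature.GroupTheory.SpecificGroups.OrthogonalThreeSymmetricNilpotentOrbitsRankOne  -- ★ (F0P3-p03): `mul_self_eq_zero_of_rank_le_one_of_isNilpotent`
import HarnessLib

/-!
# The lattice graph of a hermitian space — THE RANK OF THE DROP-1 CHILD AT A TAME-RAMIFIED PLACE: when the residual corner vanishes, the child's residual matrix is
# strictly lower triangular, of rank `2` iff `x̄ ∉ ker Ȳ`, and its kernel is the inward line (Bruhat–Tits 1972 §10; Tits 1979 §3.5; Kottwitz 1986 §3)

Topic `NumberTheory/Automorphic`; namespace `Literature.NumberTheory.Automorphic.UnitaryLatticeTree`.  THEOREMS ONLY (no definition, no instance, no notation, no named fact,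
no `sorry`); kernel lane `--supports stmt-HodgeConjecture-24833`.  Cell `pub/hodgecm-mathlib` (D-0151), crux H413; road «S3-ram» (Literature seeding, count-neutral), organ
A′ (ii) of the P-1-ram skeleton (architect A-p16 (g31)); gap **G2** of the (a2)(B) tree-induction blueprint (F0P3a-p01 (g16)): the «`E_m → q²·O_{m−1}`» and «`O_m → q·E_m`»
rows of the child-label law need the RANK of the child through a NULL line.  DATUM-FREE; two currency-free layers: §1–§2 at the level of valuations in the D∕J₀-model
(`K` with `Valued K ℤᵐ⁰`; `σ` valuation-preserving for §2), §3 pure linear algebra over ANY field (the residual shape), so that the induction (G5) instantiates §3 at the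
residues of §1 in whatever reduction currency it uses (`IsLocalRing.residue 𝒪[K]` + ★ `residue_eq_zero_iff_v_lt_one`).  Tokens of ★ `UnitaryLatticeTree*`: `L₀ = 𝒪³`,
`N₁ = latt diag(1,1,ϖ)`, child frame `g = g(a,b) = !![a∕ϖ,0,0; 0,1,0; b,0,ϖ]` (`|a| = 1`, `|b| ≤ 1`), `M` of level `ϖ^d` (`|M_{ij}| ≤ |ϖ|^d`), `M′ := g⁻¹Mg`, and the strictly
lower-triangular leading part `L = !![0,0,0; (a∕ϖ)M₁₀,0,0; (a∕ϖ²)M₂₀ + (b∕ϖ)(M₂₂−M₀₀), ϖ⁻¹M₂₁, 0]` of ★ p847187 (`M′ = L + (≤ |ϖ|^d)`).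

THE MATHEMATICS.  §1: when the corner passes (`|M₂₀| ≤ |ϖ|^{d+1}`, `d ≥ 1`) the child has level `≥ d − 1` (`v_childFrame_conj_le_of_corner`; ★ p847102's iff assumed `d ≥ 2`,
the `R → B` row is `d = 1`); at order `d − 1` the six entries `M′_{ij}`, `i ≤ j`, vanish (`v_childFrame_conj_apply_le_of_le`: they are `≤ |ϖ|^d` with NO corner hypothesis) and
the two PIVOTS are `M′₁₀ ≡ (a∕ϖ)M₁₀`, `M′₂₁ ≡ ϖ⁻¹M₂₁` (`v_childFrame_conj_one_zero_sub_le`, `…_two_one_sub_le`), so `|M′₁₀| = |ϖ|^{d−1} ↔ |M₁₀| = |ϖ|^d` and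
`|M′₂₁| = |ϖ|^{d−1} ↔ |M₂₁| = |ϖ|^d` (`v_childFrame_conj_one_zero_eq_iff`, `…_two_one_eq_iff`): the child's residual matrix of order `d − 1` is `X = !![0,0,0; α,0,0; β,γ,0]`
with `α ≠ 0 ↔ |M₁₀| = |ϖ|^d`, `γ ≠ 0 ↔ |M₂₁| = |ϖ|^d`.  §2: the two pivots stand or fall TOGETHER — for `γ ∈ U(σ, J₀)` of level `ϖ^d` the FIRST-ORDER SKEW-HERMITIAN LAW
**`|(γ−1)_{ij} + σ((γ−1)_{rev j, rev i})| ≤ |ϖ|^d·|ϖ|^d`** (`v_coe_sub_one_apply_add_sigma_rev_le`, from `B₀(γu,γv) = B₀(u,v)` expanded at `u = e_{rev i}`, `v = e_j`; its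
residue is the PARITY LEMMA «`J̄₀Ȳ` is `(−1)^{d+1}`-symmetric» of the (a2) law table), whence for `d ≥ 1` `|(γ−1)₁₀| = |ϖ|^d ↔ |(γ−1)₂₁| = |ϖ|^d`
(`v_coe_sub_one_one_zero_eq_iff`); applied to `κ⁻¹γκ` (`M = κ⁻¹(γ−1)κ`, ★ `coe_inv_mul_mul_sub_one`) the rank-2 condition is the ONE frame-intrinsic condition
`|M₁₀| = |B₀(κe₁, (γ−1)κe₀)| = |ϖ|^d`, i.e. residually `Ȳx̄ ∉ 𝓀x̄` — for nilpotent `Ȳ`: `x̄ ∉ ker Ȳ`.  §3 (any field): `X² = γα·E₂₀` (`lowerTri_sq` — the class of `Ȳ′²` is that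
of `γα` times the corner, CERT «child-class flip» BONUS, B-p14 (g39)), `X³ = 0`, **`rank X = 2 ↔ α ≠ 0 ∧ γ ≠ 0`** (`rank_lowerTri_eq_two_iff`), `rank X ≤ 1 ↔ α = 0 ∨ γ = 0`, and
for `αγ ≠ 0` **`X·z = 0 ↔ z₀ = z₁ = 0`** (`lowerTri_mulVec_eq_zero_iff`): `ker X = ⟨e₂⟩`, which in the child frame `[w(a,b) | e₁ | ϖe₂]` is the line of `ϖe₂`, i.e. the INWARD
isotropic line (the modular neighbour `N₁ = {z : z₀ ≡ 0 (ϖ)} ⊂ latt g` is its orthogonal) — so a rank-2 child loses exactly its inward line at the next step («`E → q²·O`»: all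
`q` outward lines of an even-depth child continue; «`O → q·E`»: the one outward null line does), as in CERT smoke v1.3 §6 (A-p16 (g31)).

* §1 `v_childFrame_conj_le_of_corner` (`1 ≤ d`), `v_childFrame_conj_apply_le_of_le` (`i ≤ j`), `v_childFrame_conj_one_zero_sub_le`, `v_childFrame_conj_two_one_sub_le`,
  **`v_childFrame_conj_one_zero_eq_iff`**, **`v_childFrame_conj_two_one_eq_iff`**.
* §2 **`v_coe_sub_one_apply_add_sigma_rev_le`** (first-order skew-hermitian law), **`v_coe_sub_one_one_zero_eq_iff`** (the two pivots agree).
* §3 `lowerTri_sq`, `lowerTri_pow_three`, `lowerTri_eq_vecMulVec_of_fst_eq_zero`, `lowerTri_eq_vecMulVec_of_snd_eq_zero`, `rank_lowerTri_le_two`, **`rank_lowerTri_eq_two_iff`**,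
  `rank_lowerTri_le_one_iff`, **`lowerTri_mulVec_eq_zero_iff`**.

HONEST LABEL: HC_CM is proved only modulo the 2 remaining named inputs (hLiu418 24832, h413 24833) until rung 0 closes; nothing printed is asserted here (elementary algebra
over a valuation ring and over a field); «S3-ram» has no books consequence.

## References
* [BruhatTits1972] F. Bruhat, J. Tits, *Groupes réductifs sur un corps local I*, Publ. Math. IHÉS 41 (1972), §10 (lattice models; vertex stabilisers and their filtrations).
* [Tits1979] J. Tits, *Reductive groups over local fields*, PSPM 33.1 (1979), §3.5 (congruence filtration; reduction mod `𝔭` of a parahoric).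
* [Kottwitz1986] R. E. Kottwitz, *Base change for unit elements of Hecke algebras*, Compositio Math. 60 (1986), §3 (levels of fixed lattices; shell recursion).
* [Serre1980Trees] J.-P. Serre, *Trees* (1980), Ch. II §1.1–1.2 (lattices, frames, neighbours = lines of the reduction).
* [CollingwoodMcGovern1993] D. Collingwood, W. McGovern, *Nilpotent orbits in semisimple Lie algebras* (1993), §9.3 (nilpotent `3 × 3` matrices by rank).
-/

set_option autoImplicit false

noncomputable section

open scoped Valued WithZero Matrix MatrixGroups

namespace Literature.NumberTheory.Automorphic.UnitaryLatticeTree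

open Literature.NumberTheory.Automorphic Literature.NumberTheory.Automorphic.HermitianLattice

variable {K : Type*} [Field K] [Valued K ℤᵐ⁰] {σ : K →+* K} {ϖ : K}

/-! ## §1 The child's matrix at order `d − 1` -/

/-- **Level `≥ d − 1` when the corner passes, for every `d ≥ 1`**: `|M_{ij}| ≤ |ϖ|^d`, `|M₂₀| ≤ |ϖ|^{d+1}`, `|a| = 1`, `|b| ≤ 1` ⇒ every entry of `g⁻¹Mg` is `≤ |ϖ|^{d−1}`
(★ p847102's `v_childFrame_conj_le_iff_of_le` is the iff for `d ≥ 2`; the `R → B` row of the law table is `d = 1`). [cite: Kottwitz1986, §3] [cite: Tits1979, §3.5] -/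
theorem v_childFrame_conj_le_of_corner (hϖ : Valued.v ϖ = WithZero.exp (-1 : ℤ)) {a b : K} (ha : Valued.v a = 1) (hb : Valued.v b ≤ 1)
    {d : ℕ} (hd : 1 ≤ d) {M : Matrix (Fin 3) (Fin 3) K} (hM : ∀ i j, Valued.v (M i j) ≤ Valued.v ϖ ^ d) (h20 : Valued.v (M 2 0) ≤ Valued.v ϖ ^ (d + 1)) (i j : Fin 3) :
    Valued.v (((!![ϖ / a, 0, 0; 0, 1, 0; -b / a, 0, ϖ⁻¹] : Matrix (Fin 3) (Fin 3) K) * M * !![a / ϖ, 0, 0; 0, 1, 0; b, 0, ϖ]) i j) ≤ Valued.v ϖ ^ (d - 1) := by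
  have hϖ0 : ϖ ≠ 0 := fun h0 => by rw [h0, map_zero] at hϖ; exact WithZero.coe_ne_zero hϖ.symm
  have hvϖ0 : Valued.v ϖ ≠ 0 := (Valuation.ne_zero_iff _).2 hϖ0
  have ha0 : a ≠ 0 := fun h0 => by rw [h0, map_zero] at ha; exact zero_ne_one ha
  have hϖ1 : Valued.v ϖ ≤ 1 := by rw [hϖ, ← WithZero.exp_zero]; exact WithZero.exp_le_exp.2 (by norm_num)
  have hpow : ∀ {m n : ℕ}, n ≤ m → Valued.v ϖ ^ m ≤ Valued.v ϖ ^ n := fun {m n} h => pow_le_pow_right_of_le_one' hϖ1 h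
  have hd1 : Valued.v ϖ ^ d = Valued.v ϖ * Valued.v ϖ ^ (d - 1) := by rw [← pow_succ']; congr 1; omega
  have hd3 : Valued.v ϖ ^ (d + 1) = Valued.v ϖ ^ 2 * Valued.v ϖ ^ (d - 1) := by rw [← pow_add]; congr 1; omega
  have hM'' : ∀ i j, Valued.v (M i j) ≤ Valued.v ϖ ^ (d - 1) := fun i j => (hM i j).trans (hpow (by omega))
  have hba : Valued.v (b / a) ≤ 1 := by rw [map_div₀, ha, div_one]; exact hb
  have hϖa : Valued.v (ϖ / a) ≤ 1 := by rw [map_div₀, ha, div_one]; exact hϖ1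
  have hϖba : Valued.v (ϖ * b / a) ≤ 1 := by rw [map_div₀, map_mul, ha, div_one]; exact mul_le_one' hϖ1 hb
  have hϖ2a : Valued.v (ϖ ^ 2 / a) ≤ 1 := by rw [map_div₀, map_pow, ha, div_one]; exact pow_le_one₀ zero_le hϖ1
  have hb2a : Valued.v (b ^ 2 / a) ≤ 1 := by rw [map_div₀, map_pow, ha, div_one]; exact pow_le_one₀ zero_le hb
  have hmul1 : ∀ {c x : K} {t : ℤᵐ⁰}, Valued.v c ≤ 1 → Valued.v x ≤ t → Valued.v (c * x) ≤ t := fun {c x t} hc hx => by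
    rw [map_mul]; exact (mul_le_of_le_one_left zero_le hc).trans hx
  have hsc1 : ∀ {x : K}, Valued.v x ≤ Valued.v ϖ ^ d → Valued.v (ϖ⁻¹ * x) ≤ Valued.v ϖ ^ (d - 1) := fun {x} hx => by
    rw [map_mul, map_inv₀]
    calc (Valued.v ϖ)⁻¹ * Valued.v x ≤ (Valued.v ϖ)⁻¹ * Valued.v ϖ ^ d := mul_le_mul' le_rfl hx
      _ = Valued.v ϖ ^ (d - 1) := by rw [hd1, ← mul_assoc, inv_mul_cancel₀ hvϖ0, one_mul]
  have h10 : Valued.v (a / ϖ * M 1 0) ≤ Valued.v ϖ ^ (d - 1) := by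
    have : a / ϖ * M 1 0 = a * (ϖ⁻¹ * M 1 0) := by field_simp
    rw [this, map_mul, ha, one_mul]; exact hsc1 (hM 1 0)
  have hbϖ : Valued.v (b / ϖ * (M 2 2 - M 0 0)) ≤ Valued.v ϖ ^ (d - 1) := by
    have : b / ϖ * (M 2 2 - M 0 0) = b * (ϖ⁻¹ * (M 2 2 - M 0 0)) := by field_simp
    rw [this]
    exact hmul1 hb (hsc1 ((Valuation.map_sub _ _ _).trans (max_le (hM 2 2) (hM 0 0))))
  have h21 : Valued.v (ϖ⁻¹ * M 2 1) ≤ Valued.v ϖ ^ (d - 1) := hsc1 (hM 2 1)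
  have htail : Valued.v (b / ϖ * (M 2 2 - M 0 0) - b ^ 2 / a * M 0 2) ≤ Valued.v ϖ ^ (d - 1) :=
    (Valuation.map_sub _ _ _).trans (max_le hbϖ (hmul1 hb2a (hM'' 0 2)))
  have hc : Valued.v (a / ϖ ^ 2 * M 2 0) ≤ Valued.v ϖ ^ (d - 1) := by
    rw [map_mul, map_div₀, map_pow, ha, one_div]
    have h' := mul_le_mul' (le_refl ((Valued.v ϖ ^ 2)⁻¹)) h20
    rwa [hd3, ← mul_assoc, inv_mul_cancel₀ (pow_ne_zero _ hvϖ0), one_mul] at h'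
  rw [childFrame_conj_eq hϖ0 ha0]
  fin_cases i <;> fin_cases j
  · simpa using (Valuation.map_add _ _ _).trans (max_le (hM'' 0 0) (hmul1 hϖba (hM'' 0 2)))
  · simpa using hmul1 hϖa (hM'' 0 1)
  · simpa using hmul1 hϖ2a (hM'' 0 2)
  · simpa using (Valuation.map_add _ _ _).trans (max_le h10 (hmul1 hb (hM'' 1 2)))
  · simpa using hM'' 1 1
  · simpa using hmul1 hϖ1 (hM'' 1 2)
  · have e : a / ϖ ^ 2 * M 2 0 + b / ϖ * (M 2 2 - M 0 0) - b ^ 2 / a * M 0 2 = a / ϖ ^ 2 * M 2 0 + (b / ϖ * (M 2 2 - M 0 0) - b ^ 2 / a * M 0 2) := by ring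
    simpa [e] using (Valuation.map_add _ _ _).trans (max_le hc htail)
  · simpa using (Valuation.map_sub _ _ _).trans (max_le h21 (hmul1 hba (hM'' 0 1)))
  · simpa using (Valuation.map_sub _ _ _).trans (max_le (hM'' 2 2) (hmul1 hϖba (hM'' 0 2)))

/-- **The six upper∕diagonal entries of `g⁻¹Mg` are `≤ |ϖ|^d`** (`i ≤ j`; every `d`, NO corner hypothesis): at order `d − 1` the child's residual matrix is STRICTLY LOWER
TRIANGULAR. [cite: Kottwitz1986, §3] [cite: Tits1979, §3.5] -/
theorem v_childFrame_conj_apply_le_of_le (hϖ : Valued.v ϖ = WithZero.exp (-1 : ℤ)) {a b : K} (ha : Valued.v a = 1) (hb : Valued.v b ≤ 1)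
    {d : ℕ} {M : Matrix (Fin 3) (Fin 3) K} (hM : ∀ i j, Valued.v (M i j) ≤ Valued.v ϖ ^ d) {i j : Fin 3} (hij : i ≤ j) :
    Valued.v (((!![ϖ / a, 0, 0; 0, 1, 0; -b / a, 0, ϖ⁻¹] : Matrix (Fin 3) (Fin 3) K) * M * !![a / ϖ, 0, 0; 0, 1, 0; b, 0, ϖ]) i j) ≤ Valued.v ϖ ^ d := by
  have hϖ0 : ϖ ≠ 0 := fun h0 => by rw [h0, map_zero] at hϖ; exact WithZero.coe_ne_zero hϖ.symm
  have ha0 : a ≠ 0 := fun h0 => by rw [h0, map_zero] at ha; exact zero_ne_one ha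
  have hϖ1 : Valued.v ϖ ≤ 1 := by rw [hϖ, ← WithZero.exp_zero]; exact WithZero.exp_le_exp.2 (by norm_num)
  have hϖa : Valued.v (ϖ / a) ≤ 1 := by rw [map_div₀, ha, div_one]; exact hϖ1
  have hϖba : Valued.v (ϖ * b / a) ≤ 1 := by rw [map_div₀, map_mul, ha, div_one]; exact mul_le_one' hϖ1 hb
  have hϖ2a : Valued.v (ϖ ^ 2 / a) ≤ 1 := by rw [map_div₀, map_pow, ha, div_one]; exact pow_le_one₀ zero_le hϖ1
  have hmul1 : ∀ {c x : K} {t : ℤᵐ⁰}, Valued.v c ≤ 1 → Valued.v x ≤ t → Valued.v (c * x) ≤ t := fun {c x t} hc hx => by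
    rw [map_mul]; exact (mul_le_of_le_one_left zero_le hc).trans hx
  rw [childFrame_conj_eq hϖ0 ha0]
  fin_cases i <;> fin_cases j
  · simpa using (Valuation.map_add _ _ _).trans (max_le (hM 0 0) (hmul1 hϖba (hM 0 2)))
  · simpa using hmul1 hϖa (hM 0 1)
  · simpa using hmul1 hϖ2a (hM 0 2)
  · exact absurd hij (by decide)
  · simpa using hM 1 1
  · simpa using hmul1 hϖ1 (hM 1 2)
  · exact absurd hij (by decide)
  · exact absurd hij (by decide)
  · simpa using (Valuation.map_sub _ _ _).trans (max_le (hM 2 2) (hmul1 hϖba (hM 0 2)))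

/-- **The first pivot**: `|(g⁻¹Mg)₁₀ − (a∕ϖ)M₁₀| ≤ |ϖ|^d`. [cite: Kottwitz1986, §3] [cite: Serre1980Trees, II.1.2] -/
theorem v_childFrame_conj_one_zero_sub_le (hϖ : Valued.v ϖ = WithZero.exp (-1 : ℤ)) {a b : K} (ha : Valued.v a = 1) (hb : Valued.v b ≤ 1)
    {d : ℕ} {M : Matrix (Fin 3) (Fin 3) K} (hM : ∀ i j, Valued.v (M i j) ≤ Valued.v ϖ ^ d) :
    Valued.v (((!![ϖ / a, 0, 0; 0, 1, 0; -b / a, 0, ϖ⁻¹] : Matrix (Fin 3) (Fin 3) K) * M * !![a / ϖ, 0, 0; 0, 1, 0; b, 0, ϖ]) 1 0 - a / ϖ * M 1 0) ≤ Valued.v ϖ ^ d := by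
  have h := v_childFrame_conj_sub_lower_le hϖ ha hb hM 1 0
  rw [Matrix.sub_apply] at h
  simpa using h

/-- **The second pivot**: `|(g⁻¹Mg)₂₁ − ϖ⁻¹M₂₁| ≤ |ϖ|^d`. [cite: Kottwitz1986, §3] [cite: Serre1980Trees, II.1.2] -/
theorem v_childFrame_conj_two_one_sub_le (hϖ : Valued.v ϖ = WithZero.exp (-1 : ℤ)) {a b : K} (ha : Valued.v a = 1) (hb : Valued.v b ≤ 1)
    {d : ℕ} {M : Matrix (Fin 3) (Fin 3) K} (hM : ∀ i j, Valued.v (M i j) ≤ Valued.v ϖ ^ d) :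
    Valued.v (((!![ϖ / a, 0, 0; 0, 1, 0; -b / a, 0, ϖ⁻¹] : Matrix (Fin 3) (Fin 3) K) * M * !![a / ϖ, 0, 0; 0, 1, 0; b, 0, ϖ]) 2 1 - ϖ⁻¹ * M 2 1) ≤ Valued.v ϖ ^ d := by
  have h := v_childFrame_conj_sub_lower_le hϖ ha hb hM 2 1
  rw [Matrix.sub_apply] at h
  simpa using h

/-- **First pivot of exact size**: for `d ≥ 1`, `|(g⁻¹Mg)₁₀| = |ϖ|^{d−1} ↔ |M₁₀| = |ϖ|^d` — the residue `α = red(aϖ^{−d}M₁₀)` of the child's order-`(d−1)` matrix is non-zero iff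
`M₁₀ = B₀(κe₁, (γ−1)κe₀)` is a unit multiple of `ϖ^d`. [cite: Kottwitz1986, §3] [cite: Tits1979, §3.5] -/
theorem v_childFrame_conj_one_zero_eq_iff (hϖ : Valued.v ϖ = WithZero.exp (-1 : ℤ)) {a b : K} (ha : Valued.v a = 1) (hb : Valued.v b ≤ 1)
    {d : ℕ} (hd : 1 ≤ d) {M : Matrix (Fin 3) (Fin 3) K} (hM : ∀ i j, Valued.v (M i j) ≤ Valued.v ϖ ^ d) :
    Valued.v (((!![ϖ / a, 0, 0; 0, 1, 0; -b / a, 0, ϖ⁻¹] : Matrix (Fin 3) (Fin 3) K) * M * !![a / ϖ, 0, 0; 0, 1, 0; b, 0, ϖ]) 1 0) = Valued.v ϖ ^ (d - 1) ↔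
      Valued.v (M 1 0) = Valued.v ϖ ^ d := by
  have hϖ0 : ϖ ≠ 0 := fun h0 => by rw [h0, map_zero] at hϖ; exact WithZero.coe_ne_zero hϖ.symm
  have hvϖ0 : Valued.v ϖ ≠ 0 := (Valuation.ne_zero_iff _).2 hϖ0
  have hϖlt : Valued.v ϖ < 1 := by rw [hϖ, ← WithZero.exp_zero]; exact WithZero.exp_lt_exp.2 (by norm_num)
  have hd1 : Valued.v ϖ ^ d = Valued.v ϖ * Valued.v ϖ ^ (d - 1) := by rw [← pow_succ']; congr 1; omega
  have hlt : Valued.v ϖ ^ d < Valued.v ϖ ^ (d - 1) := by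
    rw [hd1]; exact mul_lt_of_lt_one_left (zero_lt_iff.2 (pow_ne_zero _ hvϖ0)) hϖlt
  -- `|(a/ϖ)·M₁₀| = |ϖ|⁻¹·|M₁₀|`, so `= |ϖ|^(d-1) ↔ |M₁₀| = |ϖ|^d`
  have hscale : Valued.v (a / ϖ * M 1 0) = Valued.v ϖ ^ (d - 1) ↔ Valued.v (M 1 0) = Valued.v ϖ ^ d := by
    rw [map_mul, map_div₀, ha, one_div, hd1]
    constructor
    · intro h; rw [← h, ← mul_assoc, mul_inv_cancel₀ hvϖ0, one_mul]
    · intro h; rw [h, ← mul_assoc, inv_mul_cancel₀ hvϖ0, one_mul]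
  have hsub := v_childFrame_conj_one_zero_sub_le hϖ ha hb hM
  set x : K := ((!![ϖ / a, 0, 0; 0, 1, 0; -b / a, 0, ϖ⁻¹] : Matrix (Fin 3) (Fin 3) K) * M * !![a / ϖ, 0, 0; 0, 1, 0; b, 0, ϖ]) 1 0 with hx
  rw [← hscale]
  constructor
  · intro h
    have h1 : Valued.v (x - a / ϖ * M 1 0) < Valued.v x := hsub.trans_lt (h ▸ hlt)
    have h2 : Valued.v (a / ϖ * M 1 0 - x) < Valued.v x := by rwa [← neg_sub, Valuation.map_neg]
    rw [Valuation.map_eq_of_sub_lt _ h2, h]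
  · intro h
    have h1 : Valued.v (x - a / ϖ * M 1 0) < Valued.v (a / ϖ * M 1 0) := hsub.trans_lt (h ▸ hlt)
    rw [Valuation.map_eq_of_sub_lt _ h1, h]

/-- **Second pivot of exact size**: for `d ≥ 1`, `|(g⁻¹Mg)₂₁| = |ϖ|^{d−1} ↔ |M₂₁| = |ϖ|^d` (residue `γ = red(ϖ^{−d}M₂₁)` non-zero iff `M₂₁` is a unit multiple of `ϖ^d`).
[cite: Kottwitz1986, §3] [cite: Tits1979, §3.5] -/
theorem v_childFrame_conj_two_one_eq_iff (hϖ : Valued.v ϖ = WithZero.exp (-1 : ℤ)) {a b : K} (ha : Valued.v a = 1) (hb : Valued.v b ≤ 1)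
    {d : ℕ} (hd : 1 ≤ d) {M : Matrix (Fin 3) (Fin 3) K} (hM : ∀ i j, Valued.v (M i j) ≤ Valued.v ϖ ^ d) :
    Valued.v (((!![ϖ / a, 0, 0; 0, 1, 0; -b / a, 0, ϖ⁻¹] : Matrix (Fin 3) (Fin 3) K) * M * !![a / ϖ, 0, 0; 0, 1, 0; b, 0, ϖ]) 2 1) = Valued.v ϖ ^ (d - 1) ↔
      Valued.v (M 2 1) = Valued.v ϖ ^ d := by
  have hϖ0 : ϖ ≠ 0 := fun h0 => by rw [h0, map_zero] at hϖ; exact WithZero.coe_ne_zero hϖ.symm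
  have hvϖ0 : Valued.v ϖ ≠ 0 := (Valuation.ne_zero_iff _).2 hϖ0
  have hϖlt : Valued.v ϖ < 1 := by rw [hϖ, ← WithZero.exp_zero]; exact WithZero.exp_lt_exp.2 (by norm_num)
  have hd1 : Valued.v ϖ ^ d = Valued.v ϖ * Valued.v ϖ ^ (d - 1) := by rw [← pow_succ']; congr 1; omega
  have hlt : Valued.v ϖ ^ d < Valued.v ϖ ^ (d - 1) := by
    rw [hd1]; exact mul_lt_of_lt_one_left (zero_lt_iff.2 (pow_ne_zero _ hvϖ0)) hϖlt
  have hscale : Valued.v (ϖ⁻¹ * M 2 1) = Valued.v ϖ ^ (d - 1) ↔ Valued.v (M 2 1) = Valued.v ϖ ^ d := by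
    rw [map_mul, map_inv₀, hd1]
    constructor
    · intro h; rw [← h, ← mul_assoc, mul_inv_cancel₀ hvϖ0, one_mul]
    · intro h; rw [h, ← mul_assoc, inv_mul_cancel₀ hvϖ0, one_mul]
  have hsub := v_childFrame_conj_two_one_sub_le hϖ ha hb hM
  set x : K := ((!![ϖ / a, 0, 0; 0, 1, 0; -b / a, 0, ϖ⁻¹] : Matrix (Fin 3) (Fin 3) K) * M * !![a / ϖ, 0, 0; 0, 1, 0; b, 0, ϖ]) 2 1 with hx
  rw [← hscale]
  constructor
  · intro h
    have h1 : Valued.v (x - ϖ⁻¹ * M 2 1) < Valued.v x := hsub.trans_lt (h ▸ hlt)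
    have h2 : Valued.v (ϖ⁻¹ * M 2 1 - x) < Valued.v x := by rwa [← neg_sub, Valuation.map_neg]
    rw [Valuation.map_eq_of_sub_lt _ h2, h]
  · intro h
    have h1 : Valued.v (x - ϖ⁻¹ * M 2 1) < Valued.v (ϖ⁻¹ * M 2 1) := hsub.trans_lt (h ▸ hlt)
    rw [Valuation.map_eq_of_sub_lt _ h1, h]

/-! ## §2 The two pivots agree: the first-order skew-hermitian law in `U(σ, J₀)` -/

/-- **FIRST-ORDER SKEW-HERMITIAN LAW.**  For `γ ∈ U(σ, J₀)` (`J₀ = antidiag(1,1,1)`), `σ` valuation-preserving and `Y := γ − 1` of level `ϖ^d` (`|Y_{ij}| ≤ |ϖ|^d`):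
**`|Y_{ij} + σ(Y_{rev j, rev i})| ≤ |ϖ|^d·|ϖ|^d`** for all `i, j` — from `B₀(γu, γv) = B₀(u, v)` at `u = e_{rev i}`, `v = e_j`:
`Y_{ij} + σ(Y_{rev j, rev i}) = −B₀(Ye_{rev i}, Ye_j)`.  Its residue is the parity lemma «`J̄₀Ȳ` is `(−1)^{d+1}`-symmetric at a ramified place» of the (a2) law table.
[cite: Tits1979, §3.5] [cite: BruhatTits1972, §10] -/
theorem v_coe_sub_one_apply_add_sigma_rev_le (hvσ : ∀ z, Valued.v (σ z) = Valued.v z)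
    (γ : unitaryGroupOfForm σ ((StdForm.antidiagonal 3).over K)) {d : ℕ}
    (hY : ∀ i j, Valued.v ((((γ : GL (Fin 3) K) : Matrix (Fin 3) (Fin 3) K) - 1) i j) ≤ Valued.v ϖ ^ d) (i j : Fin 3) :
    Valued.v ((((γ : GL (Fin 3) K) : Matrix (Fin 3) (Fin 3) K) - 1) i j + σ ((((γ : GL (Fin 3) K) : Matrix (Fin 3) (Fin 3) K) - 1) j.rev i.rev)) ≤
      Valued.v ϖ ^ d * Valued.v ϖ ^ d := by
  set Y : Matrix (Fin 3) (Fin 3) K := ((γ : GL (Fin 3) K) : Matrix (Fin 3) (Fin 3) K) - 1 with hYdef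
  have hγu := (mem_unitaryGroupOfForm_antidiagonal_iff (γ : GL (Fin 3) K)).1 γ.2
  have hγY : ((γ : GL (Fin 3) K) : Matrix (Fin 3) (Fin 3) K) = 1 + Y := by rw [hYdef, add_sub_cancel]
  -- expand `B₀(γu, γv) = B₀(u,v)` with `γ = 1 + Y`
  have hexp : ∀ u v : Fin 3 → K, B₀ σ 3 u (Y.mulVec v) + B₀ σ 3 (Y.mulVec u) v = -B₀ σ 3 (Y.mulVec u) (Y.mulVec v) := by
    intro u v
    have h := hγu u v
    rw [hγY, Matrix.add_mulVec, Matrix.add_mulVec, Matrix.one_mulVec, Matrix.one_mulVec, map_add, map_add, LinearMap.add_apply, LinearMap.add_apply] at h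
    -- `h : B₀ u v + B₀ u (Yv) + (B₀ (Yu) v + B₀ (Yu) (Yv)) = B₀ u v`
    have h' : B₀ σ 3 u (Y.mulVec v) + B₀ σ 3 (Y.mulVec u) v + B₀ σ 3 (Y.mulVec u) (Y.mulVec v) = 0 := by
      have := sub_eq_zero.2 h
      rw [← this]; abel
    rw [eq_neg_iff_add_eq_zero, h']
  have h := hexp (Pi.single i.rev 1) (Pi.single j 1)
  rw [Matrix.mulVec_single_one, Matrix.mulVec_single_one, B₀_single_left, B₀_single_right, Fin.rev_rev] at h
  -- `h : Y i j + σ (Y j.rev i.rev) = -B₀ (Y.col i.rev) (Y.col j)`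
  have hcol : ∀ k l : Fin 3, Valued.v (Y.col l k) ≤ Valued.v ϖ ^ d := fun k l => hY k l
  rw [Matrix.col_apply, Matrix.col_apply] at h
  rw [h, Valuation.map_neg, B₀_apply]
  refine Valuation.map_sum_le _ fun k _ => ?_
  rw [map_mul, hvσ]
  exact mul_le_mul' (hcol k i.rev) (hcol k.rev j)

/-- **The two pivots agree**: for `γ ∈ U(σ, J₀)` with `γ − 1` of level `ϖ^d`, `d ≥ 1`: `|(γ−1)₁₀| = |ϖ|^d ↔ |(γ−1)₂₁| = |ϖ|^d` (`rev 0 = 2`, `rev 1 = 1`; the error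
`|ϖ|^{2d} < |ϖ|^d`).  Applied to `κ⁻¹γκ` (★ `coe_inv_mul_mul_sub_one`): the rank-2 condition of §3 is the single condition `|M₁₀| = |ϖ|^d`. [cite: Tits1979, §3.5] [cite: Kottwitz1986, §3] -/
theorem v_coe_sub_one_one_zero_eq_iff (hvσ : ∀ z, Valued.v (σ z) = Valued.v z) (hϖ : Valued.v ϖ = WithZero.exp (-1 : ℤ))
    (γ : unitaryGroupOfForm σ ((StdForm.antidiagonal 3).over K)) {d : ℕ} (hd : 1 ≤ d)
    (hY : ∀ i j, Valued.v ((((γ : GL (Fin 3) K) : Matrix (Fin 3) (Fin 3) K) - 1) i j) ≤ Valued.v ϖ ^ d) :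
    Valued.v ((((γ : GL (Fin 3) K) : Matrix (Fin 3) (Fin 3) K) - 1) 1 0) = Valued.v ϖ ^ d ↔
      Valued.v ((((γ : GL (Fin 3) K) : Matrix (Fin 3) (Fin 3) K) - 1) 2 1) = Valued.v ϖ ^ d := by
  set Y : Matrix (Fin 3) (Fin 3) K := ((γ : GL (Fin 3) K) : Matrix (Fin 3) (Fin 3) K) - 1 with hYdef
  have hϖ0 : ϖ ≠ 0 := fun h0 => by rw [h0, map_zero] at hϖ; exact WithZero.coe_ne_zero hϖ.symm
  have hvϖ0 : Valued.v ϖ ≠ 0 := (Valuation.ne_zero_iff _).2 hϖ0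
  have hϖlt : Valued.v ϖ < 1 := by rw [hϖ, ← WithZero.exp_zero]; exact WithZero.exp_lt_exp.2 (by norm_num)
  have hne : Valued.v ϖ ^ d ≠ 0 := pow_ne_zero _ hvϖ0
  have hlt : Valued.v ϖ ^ d * Valued.v ϖ ^ d < Valued.v ϖ ^ d :=
    mul_lt_of_lt_one_left (zero_lt_iff.2 hne) (pow_lt_one₀ zero_le hϖlt (by omega))
  have h := v_coe_sub_one_apply_add_sigma_rev_le hvσ γ hY 1 0
  -- `rev 0 = 2`, `rev 1 = 1`
  have hr0 : (0 : Fin 3).rev = 2 := rfl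
  have hr1 : (1 : Fin 3).rev = 1 := rfl
  rw [hr0, hr1] at h
  -- `|Y₁₀ + σ Y₂₁| < |ϖ|^d`; `|σ Y₂₁| = |Y₂₁|`
  constructor
  · intro h10
    have hlt' : Valued.v (Y 1 0 + σ (Y 2 1)) < Valued.v (Y 1 0) := (h.trans_lt hlt).trans_eq h10.symm
    have e : σ (Y 2 1) = (Y 1 0 + σ (Y 2 1)) - Y 1 0 := by ring
    rw [← hvσ, e, Valuation.map_sub_eq_of_lt_right _ hlt', h10]
  · intro h21
    have h21' : Valued.v (σ (Y 2 1)) = Valued.v ϖ ^ d := by rw [hvσ, h21]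
    have hlt' : Valued.v (Y 1 0 + σ (Y 2 1)) < Valued.v (σ (Y 2 1)) := (h.trans_lt hlt).trans_eq h21'.symm
    have e : Y 1 0 = (Y 1 0 + σ (Y 2 1)) - σ (Y 2 1) := by ring
    rw [e, Valuation.map_sub_eq_of_lt_right _ hlt', h21']

/-! ## §3 The residual shape `!![0,0,0; α,0,0; β,γ,0]` over a field: square, cube, rank, kernel -/

section Field

variable {F : Type*} [Field F]

/-- `X² = γα·E₂₀` for `X = !![0,0,0; α,0,0; β,γ,0]` — the class of `Ȳ′²` is that of `γα` times the corner (CERT «child-class flip» BONUS). [cite: CollingwoodMcGovern1993, §9.3] -/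
theorem lowerTri_sq (α β γ : F) :
    (!![0, 0, 0; α, 0, 0; β, γ, 0] : Matrix (Fin 3) (Fin 3) F) * !![0, 0, 0; α, 0, 0; β, γ, 0] = !![0, 0, 0; 0, 0, 0; γ * α, 0, 0] := by
  ext i j
  fin_cases i <;> fin_cases j
  all_goals simp [Matrix.mul_apply, Fin.sum_univ_three]

/-- `X³ = 0` for `X = !![0,0,0; α,0,0; β,γ,0]`. [cite: CollingwoodMcGovern1993, §9.3] -/
theorem lowerTri_pow_three (α β γ : F) : (!![0, 0, 0; α, 0, 0; β, γ, 0] : Matrix (Fin 3) (Fin 3) F) ^ 3 = 0 := by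
  rw [pow_succ, pow_two, lowerTri_sq]
  ext i j
  fin_cases i <;> fin_cases j
  all_goals simp [Matrix.mul_apply, Fin.sum_univ_three]

/-- `α = 0`: `X = e₂ ⊗ (β, γ, 0)` is a `vecMulVec`. [cite: CollingwoodMcGovern1993, §9.3] -/
theorem lowerTri_eq_vecMulVec_of_fst_eq_zero (β γ : F) :
    (!![0, 0, 0; 0, 0, 0; β, γ, 0] : Matrix (Fin 3) (Fin 3) F) = Matrix.vecMulVec (Pi.single 2 1) ![β, γ, 0] := by
  ext i j
  fin_cases i <;> fin_cases j <;> simp [Matrix.vecMulVec_apply]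

/-- `γ = 0`: `X = (0, α, β) ⊗ e₀` is a `vecMulVec`. [cite: CollingwoodMcGovern1993, §9.3] -/
theorem lowerTri_eq_vecMulVec_of_snd_eq_zero (α β : F) :
    (!![0, 0, 0; α, 0, 0; β, 0, 0] : Matrix (Fin 3) (Fin 3) F) = Matrix.vecMulVec ![0, α, β] (Pi.single 0 1) := by
  ext i j
  fin_cases i <;> fin_cases j <;> simp [Matrix.vecMulVec_apply]

/-- `rank X ≤ 2` (`X = P·Q` through `F²`). [cite: CollingwoodMcGovern1993, §9.3] -/
theorem rank_lowerTri_le_two (α β γ : F) : (!![0, 0, 0; α, 0, 0; β, γ, 0] : Matrix (Fin 3) (Fin 3) F).rank ≤ 2 := by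
  have h : (!![0, 0, 0; α, 0, 0; β, γ, 0] : Matrix (Fin 3) (Fin 3) F) = (!![0, 0; 1, 0; 0, 1] : Matrix (Fin 3) (Fin 2) F) * (!![α, 0, 0; β, γ, 0] : Matrix (Fin 2) (Fin 3) F) := by
    ext i j
    fin_cases i <;> fin_cases j
    all_goals simp [Matrix.mul_apply, Fin.sum_univ_two]
  rw [h]
  exact (Matrix.rank_mul_le_left _ _).trans (Matrix.rank_le_width _)

/-- **`rank X = 2 ↔ α ≠ 0 ∧ γ ≠ 0`** for `X = !![0,0,0; α,0,0; β,γ,0]` over a field: if `αγ ≠ 0` then `X² ≠ 0`, so `rank X ≥ 2` (a nilpotent of rank `≤ 1` is square-zero,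
★ `mul_self_eq_zero_of_rank_le_one_of_isNilpotent`); if `α = 0` or `γ = 0`, `X` is a `vecMulVec` of rank `≤ 1`. [cite: CollingwoodMcGovern1993, §9.3] -/
theorem rank_lowerTri_eq_two_iff (α β γ : F) :
    (!![0, 0, 0; α, 0, 0; β, γ, 0] : Matrix (Fin 3) (Fin 3) F).rank = 2 ↔ (α ≠ 0 ∧ γ ≠ 0) := by
  constructor
  · intro h
    by_contra hne
    rw [not_and_or, not_ne_iff, not_ne_iff] at hne
    rcases hne with hα | hγ
    · subst hα
      have hle : (!![0, 0, 0; 0, 0, 0; β, γ, 0] : Matrix (Fin 3) (Fin 3) F).rank ≤ 1 := by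
        rw [lowerTri_eq_vecMulVec_of_fst_eq_zero]; exact Matrix.rank_vecMulVec_le _ _
      omega
    · subst hγ
      have hle : (!![0, 0, 0; α, 0, 0; β, 0, 0] : Matrix (Fin 3) (Fin 3) F).rank ≤ 1 := by
        rw [lowerTri_eq_vecMulVec_of_snd_eq_zero]; exact Matrix.rank_vecMulVec_le _ _
      omega
  · rintro ⟨hα, hγ⟩
    have hnil : IsNilpotent (!![0, 0, 0; α, 0, 0; β, γ, 0] : Matrix (Fin 3) (Fin 3) F) := ⟨3, lowerTri_pow_three α β γ⟩
    have hsq : (!![0, 0, 0; α, 0, 0; β, γ, 0] : Matrix (Fin 3) (Fin 3) F) * !![0, 0, 0; α, 0, 0; β, γ, 0] ≠ 0 := by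
      rw [lowerTri_sq]
      intro h0
      have h20 := congrFun (congrFun h0 2) 0
      simp only [Matrix.of_apply, Matrix.cons_val', Matrix.cons_val_zero, Matrix.cons_val_two, Matrix.tail_cons, Matrix.head_cons, Matrix.zero_apply,
        mul_eq_zero] at h20
      exact h20.elim hγ hα
    have hgt : ¬ (!![0, 0, 0; α, 0, 0; β, γ, 0] : Matrix (Fin 3) (Fin 3) F).rank ≤ 1 :=
      fun hle => hsq (Literature.GroupTheory.SpecificGroups.mul_self_eq_zero_of_rank_le_one_of_isNilpotent hle hnil)
    have hle2 := rank_lowerTri_le_two α β γ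
    omega

/-- `rank X ≤ 1 ↔ α = 0 ∨ γ = 0`. [cite: CollingwoodMcGovern1993, §9.3] -/
theorem rank_lowerTri_le_one_iff (α β γ : F) :
    (!![0, 0, 0; α, 0, 0; β, γ, 0] : Matrix (Fin 3) (Fin 3) F).rank ≤ 1 ↔ (α = 0 ∨ γ = 0) := by
  have h2 := rank_lowerTri_eq_two_iff α β γ
  have hle2 := rank_lowerTri_le_two α β γ
  constructor
  · intro h
    by_contra hne
    rw [not_or] at hne
    have := h2.2 ⟨hne.1, hne.2⟩
    omega
  · intro h
    rcases h with hα | hγ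
    · subst hα; rw [lowerTri_eq_vecMulVec_of_fst_eq_zero]; exact Matrix.rank_vecMulVec_le _ _
    · subst hγ; rw [lowerTri_eq_vecMulVec_of_snd_eq_zero]; exact Matrix.rank_vecMulVec_le _ _

/-- **The kernel of the rank-2 shape is the line `⟨e₂⟩`**: for `α ≠ 0`, `γ ≠ 0`, `X·z = 0 ↔ z₀ = 0 ∧ z₁ = 0`.  In the child frame `[w(a,b) | e₁ | ϖe₂]` this is the line of
`ϖe₂`, the INWARD isotropic line of the child (its orthogonal `{z₀ ≡ 0}` is the modular neighbour `N₁`). [cite: Serre1980Trees, II.1.1] [cite: CollingwoodMcGovern1993, §9.3] -/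
theorem lowerTri_mulVec_eq_zero_iff {α γ : F} (hα : α ≠ 0) (hγ : γ ≠ 0) (β : F) (z : Fin 3 → F) :
    (!![0, 0, 0; α, 0, 0; β, γ, 0] : Matrix (Fin 3) (Fin 3) F).mulVec z = 0 ↔ (z 0 = 0 ∧ z 1 = 0) := by
  have hmul : (!![0, 0, 0; α, 0, 0; β, γ, 0] : Matrix (Fin 3) (Fin 3) F).mulVec z = ![0, α * z 0, β * z 0 + γ * z 1] := by
    ext i
    fin_cases i
    all_goals simp [Matrix.mulVec, dotProduct, Fin.sum_univ_three]
  rw [hmul]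
  constructor
  · intro h
    have h1 : α * z 0 = 0 := by simpa using congrFun h 1
    have h2 : β * z 0 + γ * z 1 = 0 := by simpa using congrFun h 2
    have hz0 : z 0 = 0 := (mul_eq_zero.1 h1).resolve_left hα
    rw [hz0, mul_zero, zero_add] at h2
    exact ⟨hz0, (mul_eq_zero.1 h2).resolve_left hγ⟩
  · rintro ⟨h0, h1⟩
    ext i
    fin_cases i
    all_goals simp [h0, h1]

end Field

end Literature.NumberTheory.Automorphic.UnitaryLatticeTree

end
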